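import Summits.Ventures.GridStability.Lyapunov.StructurePreservingPolytopeRateRoa
import Summits.Ventures.GridStability.Lyapunov.StructurePreservingRateState
import HarnessLib

/-!
# GridStability/Lyapunov/StructurePreservingPolytopeRateState — «SP-RATE-POLYTOPE», state form: on the
# ★ #91 polytope region every bus angle and every generator frequency deviation of MODEL MV-3 converges
# EXPONENTIALLY at the certified rate `ρ/2`, with explicit constants

Cell `gridfusion` (LADDER-GRIDFUSION), seat gridfusion-lyap-1 (g8); sequel of
`StructurePreservingPolytopeRateRoa.lean` (p561146: `V(X t) ≤ 3C·V(X 0)·e^{−ρt}` along every solution from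
`S = {V ≤ c} ∩ 𝒫 ∩ leaf` given an `EdgeRateCert` and a leaf-Poincaré pair `(A, B)`), in the manner of g7's
window file `StructurePreservingRateState.lean` (p549349). The energy bound is turned into bounds on the
STATE:
* `D_mul_sq_le_mul_phaseEnergy_vt` — at a phase point of the closed polytope on the leaf with `V ≤ c`:
  `Dᵢ·(δᵢ − δ₀ᵢ)² ≤ L·V` for every `L` with `A/m ≤ L`, `B ≤ L` (`Dᵢφᵢ² ≤ Φ ≤ A·Q + B·K`, `m·Q ≤ W`);
* **`abs_angle_sub_le_vt`** — along every global solution from `S`, for all `t ≥ 0` and every bus `i`: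
  `|δᵢ(t) − δ₀ᵢ| ≤ √(3CL·V(X 0)/Dᵢ)·e^{−(ρ/2)t}`;
* **`abs_speed_le_vt`** — for every generator `i`: `|ωᵢ(t)| ≤ √(6C·V(X 0)/Mᵢ)·e^{−(ρ/2)t}`
  (`½Mᵢωᵢ² ≤ K ≤ V` since `W ≥ 0` on the closed polytope);
* `abs_sub_le_of_isSolution_vt` — both bounds on model-2's printed second-order solutions.
THREE COLUMNS: mathematics about MODEL MV-3 (any `n`, graph, damping pattern); `ρ/2` is a certified LOWER
bound on the exponential rate of the state inside `S`; the constants are generous (the energy controls the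
angles only through the D-weighted leaf bound); no sentence here says a grid is stable or well damped. No
definition, no named fact; standard axioms. [cite: Khalil2002, Theorem 4.10 and Definition 4.5]
-/

noncomputable section

open Set Filter Topology Real Finset
open Summit.Ventures.GridStability.Models.StructurePreserving
open Summit.Ventures.GridStability.Models.StructurePreserving.Params
open Literature.MathematicalPhysics.PowerSystems.ClassicalModel.LosslessSystem (vtGap)

namespace Summit.Ventures.GridStability.Lyapunov.StructurePreserving

variable {n : ℕ}

/-- **`Dᵢ·φᵢ² ≤ L·V` on the polytope sublevel** (`φ = δ − δ₀`): well-formed data, `b ≥ 0`, coupled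
`|σ*| ≤ π/2`, a certificate `EdgeRateCert p δ₀ c m k ℓ u` with `0 < m`; at a phase point of the closed
polytope on the momentum leaf with `V ≤ c` and the leaf-Poincaré pair `Σ Dᵢφᵢ² ≤ A·Q + B·K`
(`0 ≤ A`): `Dᵢφᵢ² ≤ L·V` whenever `A/m ≤ L` and `B ≤ L` (`m·Q ≤ W`, `V = K + W`). [folklore] -/
theorem D_mul_sq_le_mul_phaseEnergy_vt {p : Params n} (hp : p.WellFormed) (hb : ∀ i j, 0 ≤ p.b i j)
    {δ₀ : Fin n → ℝ} (h0 : ∀ i j, p.b i j ≠ 0 → |δ₀ i - δ₀ j| ≤ π / 2)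
    {c m k : ℝ} {ℓ u : Fin n → Fin n → ℝ} (hc : EdgeRateCert p δ₀ c m k ℓ u) (hm : 0 < m)
    {x : (Fin n → ℝ) × (Fin n → ℝ)} (hP : ∀ i j, p.b i j ≠ 0 → |(x.1 i - x.1 j) + (δ₀ i - δ₀ j)| ≤ π)
    (hV : phaseEnergy p δ₀ x ≤ c) {A B : ℝ} (hA : 0 ≤ A)
    (hPoinc : ∑ i, p.D i * (x.1 i - δ₀ i) ^ 2
      ≤ A * ((1 / 2) * ∑ i, ∑ j, p.b i j * (((x.1 i - x.1 j) - (δ₀ i - δ₀ j)) ^ 2 / 2))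
        + B * p.kinetic x.2)
    {L : ℝ} (hLA : A / m ≤ L) (hLB : B ≤ L) (i : Fin n) :
    p.D i * (x.1 i - δ₀ i) ^ 2 ≤ L * phaseEnergy p δ₀ x := by
  set K : ℝ := p.kinetic x.2 with hK
  set W : ℝ := p.potential δ₀ x.1 with hW
  set Qx : ℝ := (1 / 2) * ∑ i, ∑ j, p.b i j * (((x.1 i - x.1 j) - (δ₀ i - δ₀ j)) ^ 2 / 2)
    with hQx
  have hK0 : 0 ≤ K := p.kinetic_nonneg (fun j hj => (hp.M_pos j hj).le) x.2
  have hW0 : 0 ≤ W := p.potential_nonneg hb h0 hP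
  have hmQ : m * Qx ≤ W := hc.potential_ge_mul_quadratic_vt hp hb h0 hP hV
  have hQW : Qx ≤ W / m := by
    rw [le_div_iff₀ hm, mul_comm]
    exact hmQ
  have hsingle : p.D i * (x.1 i - δ₀ i) ^ 2 ≤ ∑ j, p.D j * (x.1 j - δ₀ j) ^ 2 :=
    Finset.single_le_sum (f := fun j => p.D j * (x.1 j - δ₀ j) ^ 2)
      (fun j _ => mul_nonneg (hp.D_pos j).le (sq_nonneg _)) (Finset.mem_univ i)
  have hL0 : 0 ≤ L := le_trans (div_nonneg hA hm.le) hLA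
  have hV : phaseEnergy p δ₀ x = K + W := rfl
  have h1 : A * Qx ≤ (A / m) * W := by
    have := mul_le_mul_of_nonneg_left hQW hA
    have e : A * (W / m) = (A / m) * W := by ring
    linarith [e]
  have h2 : (A / m) * W ≤ L * W := mul_le_mul_of_nonneg_right hLA hW0
  have h3 : B * K ≤ L * K := mul_le_mul_of_nonneg_right hLB hK0
  rw [hV, mul_add]
  linarith

/-- **Every bus angle converges exponentially at rate `ρ/2` on the polytope region.** Under the data of
`phaseEnergy_le_mul_exp_neg_vt` (p561146: certificate, Poincaré pair, `ρ(2 + hB) ≤ 2h`,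
`ρ(1 + hA/m) ≤ hk`, gain `C`) and `A/m ≤ L`, `B ≤ L`, `0 ≤ B`: along every global solution `X` from
`S = {V ≤ c} ∩ 𝒫 ∩ leaf`, for all `t ≥ 0` and every bus `i`,
`|δᵢ(t) − δ₀ᵢ| ≤ √(3CL·V(X 0)/Dᵢ)·exp(−(ρ/2)t)`. MODEL MV-3; `ρ/2` is a certified lower bound on the
model's rate inside `S`; no sentence here says a grid is stable or well damped.
[cite: Khalil2002, Theorem 4.10 and Definition 4.5] -/
theorem abs_angle_sub_le_vt {p : Params n} (hp : p.WellFormed) (hn : n ≠ 0)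
    (hconn : p.couplingGraph.Preconnected) (hb : ∀ i j, 0 ≤ p.b i j)
    {δ₀ : Fin n → ℝ} (h0 : ∀ i j, p.b i j ≠ 0 → |δ₀ i - δ₀ j| < π / 2) (hδ₀ : p.IsSyncEquilibrium δ₀)
    {c : ℝ} (hcgap : ∀ i j, p.b i j ≠ 0 → c < p.b i j * vtGap (δ₀ i - δ₀ j))
    {m k : ℝ} {ℓ u : Fin n → Fin n → ℝ} (hc : EdgeRateCert p δ₀ c m k ℓ u) (hm : 0 < m)
    {h : ℝ} (hh : 0 < h) (hhM : ∀ i ∈ p.gen, 2 * h * p.M i ≤ p.D i)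
    {A B : ℝ} (hA : 0 ≤ A) (hB : 0 ≤ B)
    (hPoinc : ∀ x : (Fin n → ℝ) × (Fin n → ℝ), x ∈ constraintSet p δ₀ →
      ∑ i, p.D i * (x.1 i - δ₀ i) ^ 2
        ≤ A * ((1 / 2) * ∑ i, ∑ j, p.b i j * (((x.1 i - x.1 j) - (δ₀ i - δ₀ j)) ^ 2 / 2))
          + B * p.kinetic x.2)
    {ρ : ℝ} (hρ0 : 0 ≤ ρ) (hρK : ρ * (2 + h * B) ≤ 2 * h) (hρW : ρ * (1 + h * A / m) ≤ h * k)
    {C : ℝ} (hCK : 2 + h * B ≤ C) (hCW : 1 + h * A / m ≤ C) {L : ℝ} (hLA : A / m ≤ L) (hLB : B ≤ L)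
    {X : ℝ → (Fin n → ℝ) × (Fin n → ℝ)}
    (hX0 : X 0 ∈ vtPolytope p δ₀ ∩ constraintSet p δ₀ ∧ phaseEnergy p δ₀ (X 0) ≤ c)
    (hX : ∀ T : ℝ, ∀ t ∈ Icc 0 T, HasDerivWithinAt X (phaseField p (X t)) (Icc 0 T) t)
    {t : ℝ} (ht : 0 ≤ t) (i : Fin n) :
    |(X t).1 i - δ₀ i|
      ≤ Real.sqrt (3 * C * L * phaseEnergy p δ₀ (X 0) / p.D i) * Real.exp (-(ρ / 2) * t) := by
  obtain ⟨-, hall⟩ := vtSublevel_subset_regionOfAttraction hp hn hconn hb h0 hδ₀ hcgap hX0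
  obtain ⟨hstay, -⟩ := hall X rfl hX
  have h0' : ∀ a b, p.b a b ≠ 0 → |δ₀ a - δ₀ b| ≤ π / 2 := fun a b hab => (h0 a b hab).le
  have hmem := hstay t ht
  have hPt : ∀ a b, p.b a b ≠ 0 → |((X t).1 a - (X t).1 b) + (δ₀ a - δ₀ b)| ≤ π :=
    fun a b hab => (hmem.1.1 a b hab).le
  have hdec := phaseEnergy_le_mul_exp_neg_vt hp hn hconn hb h0 hδ₀ hcgap hc hm hh hhM hA hPoinc hρ0 hρK
    hρW hCK hCW hX0 hX ht
  have hsq := D_mul_sq_le_mul_phaseEnergy_vt hp hb h0' hc hm hPt hmem.2 hA (hPoinc (X t) hmem.1.2)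
    hLA hLB i
  set V0 := phaseEnergy p δ₀ (X 0) with hV0
  have hDi := hp.D_pos i
  have hL0 : 0 ≤ L := le_trans hB hLB
  have hC0 : 0 ≤ C := by
    have : 0 ≤ h * B := mul_nonneg hh.le hB
    linarith
  -- `V(X 0) ≥ 0` on the closed polytope
  have hP0 : ∀ a b, p.b a b ≠ 0 → |((X 0).1 a - (X 0).1 b) + (δ₀ a - δ₀ b)| ≤ π :=
    fun a b hab => (hX0.1.1 a b hab).le
  have hV00 : 0 ≤ V0 := p.energy_nonneg hp hb h0' hP0 (X 0).2
  -- `φᵢ² ≤ (3CL·V0/Dᵢ)·e^{−ρt}`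
  have h1 : p.D i * ((X t).1 i - δ₀ i) ^ 2 ≤ L * (3 * C * V0 * Real.exp (-ρ * t)) :=
    hsq.trans (mul_le_mul_of_nonneg_left hdec hL0)
  have hB0 : 0 ≤ 3 * C * L * V0 / p.D i := by positivity
  have hφ2 : ((X t).1 i - δ₀ i) ^ 2 ≤ (3 * C * L * V0 / p.D i) * Real.exp (-ρ * t) := by
    have e : (3 * C * L * V0 / p.D i) * Real.exp (-ρ * t)
        = (L * (3 * C * V0 * Real.exp (-ρ * t))) / p.D i := by
      field_simp
    rw [e, le_div_iff₀ hDi]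
    linarith
  exact abs_le_sqrt_mul_exp_of_sq_le hB0 hφ2

/-- **Every generator frequency deviation converges exponentially at rate `ρ/2` on the polytope region**:
under the data of `phaseEnergy_le_mul_exp_neg_vt`, for all `t ≥ 0` and every generator `i`,
`|ωᵢ(t)| ≤ √(6C·V(X 0)/Mᵢ)·exp(−(ρ/2)t)` (`½Mᵢωᵢ² ≤ K ≤ V(X t)` since `W ≥ 0` on the closed polytope).
MODEL MV-3; no sentence here says a grid is stable or well damped.
[cite: Khalil2002, Theorem 4.10 and Definition 4.5] -/
theorem abs_speed_le_vt {p : Params n} (hp : p.WellFormed) (hn : n ≠ 0)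
    (hconn : p.couplingGraph.Preconnected) (hb : ∀ i j, 0 ≤ p.b i j)
    {δ₀ : Fin n → ℝ} (h0 : ∀ i j, p.b i j ≠ 0 → |δ₀ i - δ₀ j| < π / 2) (hδ₀ : p.IsSyncEquilibrium δ₀)
    {c : ℝ} (hcgap : ∀ i j, p.b i j ≠ 0 → c < p.b i j * vtGap (δ₀ i - δ₀ j))
    {m k : ℝ} {ℓ u : Fin n → Fin n → ℝ} (hc : EdgeRateCert p δ₀ c m k ℓ u) (hm : 0 < m)
    {h : ℝ} (hh : 0 < h) (hhM : ∀ i ∈ p.gen, 2 * h * p.M i ≤ p.D i)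
    {A B : ℝ} (hA : 0 ≤ A) (hB : 0 ≤ B)
    (hPoinc : ∀ x : (Fin n → ℝ) × (Fin n → ℝ), x ∈ constraintSet p δ₀ →
      ∑ i, p.D i * (x.1 i - δ₀ i) ^ 2
        ≤ A * ((1 / 2) * ∑ i, ∑ j, p.b i j * (((x.1 i - x.1 j) - (δ₀ i - δ₀ j)) ^ 2 / 2))
          + B * p.kinetic x.2)
    {ρ : ℝ} (hρ0 : 0 ≤ ρ) (hρK : ρ * (2 + h * B) ≤ 2 * h) (hρW : ρ * (1 + h * A / m) ≤ h * k)
    {C : ℝ} (hCK : 2 + h * B ≤ C) (hCW : 1 + h * A / m ≤ C)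
    {X : ℝ → (Fin n → ℝ) × (Fin n → ℝ)}
    (hX0 : X 0 ∈ vtPolytope p δ₀ ∩ constraintSet p δ₀ ∧ phaseEnergy p δ₀ (X 0) ≤ c)
    (hX : ∀ T : ℝ, ∀ t ∈ Icc 0 T, HasDerivWithinAt X (phaseField p (X t)) (Icc 0 T) t)
    {t : ℝ} (ht : 0 ≤ t) {i : Fin n} (hi : i ∈ p.gen) :
    |(X t).2 i| ≤ Real.sqrt (6 * C * phaseEnergy p δ₀ (X 0) / p.M i) * Real.exp (-(ρ / 2) * t) := by
  obtain ⟨-, hall⟩ := vtSublevel_subset_regionOfAttraction hp hn hconn hb h0 hδ₀ hcgap hX0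
  obtain ⟨hstay, -⟩ := hall X rfl hX
  have h0' : ∀ a b, p.b a b ≠ 0 → |δ₀ a - δ₀ b| ≤ π / 2 := fun a b hab => (h0 a b hab).le
  have hmem := hstay t ht
  have hPt : ∀ a b, p.b a b ≠ 0 → |((X t).1 a - (X t).1 b) + (δ₀ a - δ₀ b)| ≤ π :=
    fun a b hab => (hmem.1.1 a b hab).le
  have hdec := phaseEnergy_le_mul_exp_neg_vt hp hn hconn hb h0 hδ₀ hcgap hc hm hh hhM hA hPoinc hρ0 hρK
    hρW hCK hCW hX0 hX ht
  set V0 := phaseEnergy p δ₀ (X 0) with hV0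
  have hMi := hp.M_pos i hi
  have hC0 : 0 ≤ C := by
    have : 0 ≤ h * B := mul_nonneg hh.le hB
    linarith
  have hP0 : ∀ a b, p.b a b ≠ 0 → |((X 0).1 a - (X 0).1 b) + (δ₀ a - δ₀ b)| ≤ π :=
    fun a b hab => (hX0.1.1 a b hab).le
  have hV00 : 0 ≤ V0 := p.energy_nonneg hp hb h0' hP0 (X 0).2
  have hWt : 0 ≤ p.potential δ₀ (X t).1 := p.potential_nonneg hb h0' hPt
  have hK := p.half_M_mul_sq_le_kinetic (fun j hj => (hp.M_pos j hj).le) (X t).2 hi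
  have hVt : phaseEnergy p δ₀ (X t) = p.kinetic (X t).2 + p.potential δ₀ (X t).1 := rfl
  have h1 : (1 / 2) * (p.M i * (X t).2 i ^ 2) ≤ 3 * C * V0 * Real.exp (-ρ * t) := by linarith
  have hB0 : 0 ≤ 6 * C * V0 / p.M i := by positivity
  have hω2 : (X t).2 i ^ 2 ≤ (6 * C * V0 / p.M i) * Real.exp (-ρ * t) := by
    have e : (6 * C * V0 / p.M i) * Real.exp (-ρ * t) = (2 * (3 * C * V0 * Real.exp (-ρ * t))) / p.M i := by
      field_simp
      ring
    rw [e, le_div_iff₀ hMi]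
    nlinarith
  exact abs_le_sqrt_mul_exp_of_sq_le hB0 hω2

/-! ### Back to the printed second-order form -/

/-- **«SP-RATE-POLYTOPE» in coordinates, printed vocabulary (frame rotating at `ω₀`).** Under the data of
`phaseEnergy_le_mul_exp_neg_vt` with `A/m ≤ L`, `B ≤ L`, every solution `δ` of the shifted
structure-preserving model in model-2's second-order sense (`p.shifted.IsSolution δ`) whose initial state
has every coupled line angle in the polytope `|(δᵢ(0) − δⱼ(0)) + (δ₀ᵢ − δ₀ⱼ)| < π`, momentum
`L(δ(0), δ̇(0)) = L(δ₀, 0)` and energy `V₀ = V(δ(0), δ̇(0)) ≤ c` satisfies, for all `t ≥ 0`: every bus angle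
`|δᵢ(t) − δ₀ᵢ| ≤ √(3CL·V₀/Dᵢ)·e^{−(ρ/2)t}` and every generator frequency deviation
`|δ̇ᵢ(t)| ≤ √(6C·V₀/Mᵢ)·e^{−(ρ/2)t}`. No sentence here says a grid is stable or well damped.
[cite: Padiyar2013, §3.2 eqs (3.2)–(3.5), (3.11)]; [cite: Khalil2002, Theorem 4.10 and Definition 4.5] -/
theorem abs_sub_le_of_isSolution_vt {p : Params n} (hp : p.WellFormed) (hn : n ≠ 0)
    (hconn : p.couplingGraph.Preconnected) (hb : ∀ i j, 0 ≤ p.b i j)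
    {δ₀ : Fin n → ℝ} (h0 : ∀ i j, p.b i j ≠ 0 → |δ₀ i - δ₀ j| < π / 2) (hδ₀ : p.IsSyncEquilibrium δ₀)
    {c : ℝ} (hcgap : ∀ i j, p.b i j ≠ 0 → c < p.b i j * vtGap (δ₀ i - δ₀ j))
    {m k : ℝ} {ℓ u : Fin n → Fin n → ℝ} (hc : EdgeRateCert p δ₀ c m k ℓ u) (hm : 0 < m)
    {h : ℝ} (hh : 0 < h) (hhM : ∀ i ∈ p.gen, 2 * h * p.M i ≤ p.D i)
    {A B : ℝ} (hA : 0 ≤ A) (hB : 0 ≤ B)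
    (hPoinc : ∀ x : (Fin n → ℝ) × (Fin n → ℝ), x ∈ constraintSet p δ₀ →
      ∑ i, p.D i * (x.1 i - δ₀ i) ^ 2
        ≤ A * ((1 / 2) * ∑ i, ∑ j, p.b i j * (((x.1 i - x.1 j) - (δ₀ i - δ₀ j)) ^ 2 / 2))
          + B * p.kinetic x.2)
    {ρ : ℝ} (hρ0 : 0 ≤ ρ) (hρK : ρ * (2 + h * B) ≤ 2 * h) (hρW : ρ * (1 + h * A / m) ≤ h * k)
    {C : ℝ} (hCK : 2 + h * B ≤ C) (hCW : 1 + h * A / m ≤ C) {L : ℝ} (hLA : A / m ≤ L) (hLB : B ≤ L)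
    {δ : ℝ → Fin n → ℝ} (hδ : p.shifted.IsSolution δ)
    (hpol : ∀ i j, p.b i j ≠ 0 → |(δ 0 i - δ 0 j) + (δ₀ i - δ₀ j)| < π)
    (hL : p.momentum (δ 0) (fun i => deriv (fun s => δ s i) 0) = p.momentum δ₀ 0)
    (hV : p.energy δ₀ (δ 0) (fun i => deriv (fun s => δ s i) 0) ≤ c) {t : ℝ} (ht : 0 ≤ t) :
    (∀ i, |δ t i - δ₀ i|
        ≤ Real.sqrt (3 * C * L * p.energy δ₀ (δ 0) (fun i => deriv (fun s => δ s i) 0) / p.D i)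
          * Real.exp (-(ρ / 2) * t)) ∧
    ∀ i ∈ p.gen, |deriv (fun s => δ s i) t|
        ≤ Real.sqrt (6 * C * p.energy δ₀ (δ 0) (fun i => deriv (fun s => δ s i) 0) / p.M i)
          * Real.exp (-(ρ / 2) * t) := by
  set X : ℝ → (Fin n → ℝ) × (Fin n → ℝ) :=
    fun s => (δ s, fun i => if i ∈ p.gen then deriv (fun u => δ u i) s else 0) with hXdef
  have hgen : ∀ s, ∀ i ∈ p.gen, (X s).2 i = deriv (fun u => δ u i) s := fun s i hi => by
    simp [hXdef, hi]
  have hXsol : ∀ T : ℝ, ∀ t ∈ Icc 0 T, HasDerivWithinAt X (phaseField p (X t)) (Icc 0 T) t :=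
    fun T t _ => (hasDerivAt_phase_of_isSolution hp hδ t).hasDerivWithinAt
  have hy : X 0 ∈ vtPolytope p δ₀ ∩ constraintSet p δ₀ ∧ phaseEnergy p δ₀ (X 0) ≤ c := by
    refine ⟨⟨hpol, ?_, fun i hi => by simp [hXdef, hi]⟩, ?_⟩
    · rw [momentum_congr_gen p (δ 0) (hgen 0)]
      exact hL
    · rw [phaseEnergy_apply, energy_congr_gen p δ₀ (δ 0) (hgen 0)]
      exact hV
  have hE0 : phaseEnergy p δ₀ (X 0) = p.energy δ₀ (δ 0) (fun i => deriv (fun s => δ s i) 0) := by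
    rw [phaseEnergy_apply, energy_congr_gen p δ₀ (δ 0) (hgen 0)]
  refine ⟨fun i => ?_, fun i hi => ?_⟩
  · have h1 := abs_angle_sub_le_vt hp hn hconn hb h0 hδ₀ hcgap hc hm hh hhM hA hB hPoinc hρ0 hρK hρW hCK
      hCW hLA hLB hy hXsol ht i
    rw [hE0] at h1
    exact h1
  · have h1 := abs_speed_le_vt hp hn hconn hb h0 hδ₀ hcgap hc hm hh hhM hA hB hPoinc hρ0 hρK hρW hCK
      hCW hy hXsol ht hi
    rw [hE0, hgen t i hi] at h1
    exact h1

end Summit.Ventures.GridStability.Lyapunov.StructurePreserving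

end
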